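import Mathlib
import Summits.ValiantsHypothesis.ValiantsHypothesis.Theorems.DivisionGapPerMultiplesHardStubHostBlockProjection
import Summits.ValiantsHypothesis.ValiantsHypothesis.Theorems.DivisionGapPerMultiplesHardStubHostBlockParts
import Literature.Computability.AlgebraicComplexity.ArithCircuitProofs
import Literature.Computability.AlgebraicComplexity.PermanentIrreducible

/-!
# `DivisionGap.PerMultiplesHard` (stmt-ValiantsHypothesis-5068), line `uncharged-face-walk`:
the block projection SLICED along the maximal block-diagonal mass (stub `stub_blockSliceParts`)

Let `G ⊆ [n]²` be a host and `per_G = Σ_{σ ⊆ G} x^{μ_σ}` its face permanent.  Let `h ≠ 0` be a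
multiplier over `ℝ≥0`, and let `A` (rows) and `B` (columns) be read through bijections
`eA : Fin a ≃ A`, `eB : Fin a ≃ B`.  A cell `(x, y)` is BLOCK-DIAGONAL when `x ∈ A ↔ y ∈ B`; the
BLOCK-DIAGONAL MASS of an exponent `m` is the degree of its block-diagonal part
`m.filter blockdiag`.  Suppose the exponents of `h` have block-diagonal mass at most `μ`, with
equality somewhere, and `G` contains a block-diagonal permutation.  Then there is `q ≠ 0` on the
`a`-board whose exponents are exactly the `A × B`-parts, pulled back along `(eA, eB)`, of the
exponents of `h` of block-diagonal mass `μ`, with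

  `L⁺(per_{G'} · q) ≤ L⁺(per_G · h) + 1`,   `G' = {(x, y) : (eA x, eB y) ∈ G}`,

for the tree's monotone fan-in-two `complexity` over `ℝ≥0`.  This is the landed
`HostBlockParts.stub_hostBlockParts` (the case `μ = D` of a degree-`D`-homogeneous `h`, where
"mass `μ`" means "every cell block-diagonal") with the top form SLICED at mass `μ`.  All moves
are free over `ℝ≥0`:

1. TOP FORM for the indicator weight `w` of the block-diagonal cells (`topComponent_mul`,
   `complexity_topComponent_le`): the `w`-weight of an exponent IS its block-diagonal mass
   (`weight_indicator_eq_degree_filter`), so the exponents of `top_w h` are EXACTLY the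
   exponents of `h` of mass `μ` (`mem_support_topComponent_iff`), and
   `top_w per_G = Σ_{σ ⊆ G block-diagonal} x^{μ_σ}` (`HostBlockProjection.topComponent_facePer_eq`).
2. ONE PROJECTION onto the `a`-board (`IsProjection.complexity_le_holds`): the cell
   `(eA s, eB t)` goes to `X (s, t)`, every other cell to `1` (in particular the off-block cells
   of the sliced exponents).  Then `top_w per_G ↦ N · per_{G'}`, `N ≠ 0`
   (`HostBlockProjection.sum_aeval_prj_eq`, the fibre count) and `top_w h ↦ q`, whose support
   is the set of pulled-back mass-`μ` exponents (`HostBlockParts.mem_support_aeval_prj_iff`: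
   `prj (c x^m) = c x^{pb m}`, and coefficients in `ℝ≥0` add without cancellation).
3. RESCALE by `N⁻¹` (`HostBlockParts.complexity_mul_aeval_topComponent_le`, one gate).

Log (stub-worker): written on the landed `HostBlockParts` / `HostBlockProjection` /
`TopComponentFree` API; the degree-homogeneity hypothesis of the registered signature is not
used; playbook: none fit. [folklore]
-/

noncomputable section

set_option linter.dupNamespace false

open MvPolynomial Literature.Computability.AlgebraicComplexity
open scoped NNReal BigOperators
open Summit.ValiantsHypothesis.ValiantsHypothesis.Theorems.ZeroOneTransfer.Negative
open Summit.ValiantsHypothesis.ValiantsHypothesis.Theorems.DivisionGap.PerMultiplesHard.HostBlockProjection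
  (topComponent_facePer_eq sum_aeval_prj_eq)
open Summit.ValiantsHypothesis.ValiantsHypothesis.Theorems.DivisionGap.PerMultiplesHard.HostBlockParts
  (exists_pb pb_eq_iff mem_support_aeval_prj_iff complexity_mul_aeval_topComponent_le)

namespace Summit.ValiantsHypothesis.ValiantsHypothesis.Theorems.DivisionGap.PerMultiplesHard.BlockSliceParts

/-! ### The top component for an indicator weight, sliced at the maximal mass -/

/-- **Indicator weights are partial degrees.**  For an indicator weight `𝟙_P`, the weight of an
exponent `d` is the degree of its `P`-part `d.filter P`. [folklore] -/
theorem weight_indicator_eq_degree_filter {α : Type*} (P : α → Prop) [DecidablePred P]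
    (d : α →₀ ℕ) :
    Finsupp.weight (fun e => if P e then 1 else 0) d = (d.filter P).degree := by
  rw [Finsupp.weight_apply, Finsupp.degree_apply, Finsupp.sum, Finsupp.support_filter,
    Finset.sum_filter]
  refine Finset.sum_congr rfl fun e _ => ?_
  rw [Finsupp.filter_apply]
  split_ifs <;> simp

/-- **Support of the top `𝟙_P`-component, sliced form.**  If the `P`-parts of the exponents of
`h` have degree at most `μ`, with equality at some exponent, then the exponents of `top_{𝟙_P} h`
are exactly the exponents of `h` whose `P`-part has degree `μ`. [folklore] -/
theorem mem_support_topComponent_iff {α : Type*} {h : MvPolynomial α ℝ≥0} (P : α → Prop)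
    [DecidablePred P] {μ : ℕ} {d₀ : α →₀ ℕ} (hd₀ : d₀ ∈ h.support)
    (hd₀μ : (d₀.filter P).degree = μ) (hle : ∀ d ∈ h.support, (d.filter P).degree ≤ μ)
    (d : α →₀ ℕ) :
    d ∈ (topComponent (fun e => if P e then 1 else 0) h).support ↔
      d ∈ h.support ∧ (d.filter P).degree = μ := by
  have hW : weightedTotalDegree (fun e => if P e then 1 else 0) h = μ := by
    refine le_antisymm (Finset.sup_le fun d' hd' => ?_) ?_
    · rw [weight_indicator_eq_degree_filter]
      exact hle d' hd'
    · rw [← hd₀μ, ← weight_indicator_eq_degree_filter P d₀]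
      exact le_weightedTotalDegree _ hd₀
  rw [mem_support_iff, coeff_topComponent, hW, weight_indicator_eq_degree_filter, mem_support_iff]
  constructor
  · intro h1
    by_cases h2 : (d.filter P).degree = μ
    · rw [if_pos h2] at h1
      exact ⟨h1, h2⟩
    · rw [if_neg h2] at h1
      exact absurd rfl h1
  · rintro ⟨h1, h2⟩
    rw [if_pos h2]
    exact h1

/-! ### The stub -/

/-- **Block projection sliced along the maximal block-diagonal mass (stub `stub_blockSliceParts`
of line `uncharged-face-walk`).**  If `h ≠ 0`, the exponents of `h` have block-diagonal mass (the
degree of their part on the cells `(x, y)` with `x ∈ A ↔ y ∈ B`, `#A = #B = a`, read through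
`eA`, `eB`) at most `μ` with equality somewhere, and the host `G` contains a block-diagonal
permutation, then there is `q ≠ 0` on the `a`-board whose exponents are exactly the
`A × B`-parts (pulled back along `(eA, eB)`) of the exponents of `h` of block-diagonal mass `μ`,
with `L⁺(per_{G'} · q) ≤ L⁺(per_G · h) + 1` for the induced host
`G' = {(x, y) : (eA x, eB y) ∈ G}`: `q := prj (top_w h)` for the block-diagonal indicator weight
`w` (whose weight is the block-diagonal mass) and the projection `prj` onto the `a`-board; one
free top form, one free projection (`top_w per_G ↦ N · per_{G'}`, `N ≠ 0`, by the fibre count),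
one rescaling gate.  The degree-homogeneity hypothesis is not needed. [folklore] -/
theorem stub_blockSliceParts :
    ∀ (n : ℕ) (G : Finset (Fin n × Fin n)) (h : MvPolynomial (Fin n × Fin n) ℝ≥0), h ≠ 0 →
      ∀ (D : ℕ), (∀ d ∈ h.support, d.degree = D) →
      ∀ (A B : Finset (Fin n)) (a : ℕ) (eA : Fin a ≃ {x // x ∈ A}) (eB : Fin a ≃ {x // x ∈ B}) (μ : ℕ),
        (∃ m ∈ h.support, (m.filter (fun e : Fin n × Fin n => (e.1 ∈ A ↔ e.2 ∈ B))).degree = μ) →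
        (∀ m ∈ h.support, (m.filter (fun e : Fin n × Fin n => (e.1 ∈ A ↔ e.2 ∈ B))).degree ≤ μ) →
        (∃ σ : Equiv.Perm (Fin n), (∀ i, (σ i, i) ∈ G) ∧ ∀ i, σ i ∈ A ↔ i ∈ B) →
        ∃ q : MvPolynomial (Fin a × Fin a) ℝ≥0, q ≠ 0 ∧
          (∀ m' : (Fin a × Fin a) →₀ ℕ, m' ∈ q.support ↔
            ∃ m ∈ h.support, (m.filter (fun e : Fin n × Fin n => (e.1 ∈ A ↔ e.2 ∈ B))).degree = μ ∧
              ∀ x y : Fin a, m' (x, y) = m ((eA x : Fin n), (eB y : Fin n))) ∧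
          complexity ((∑ σ ∈ (Finset.univ : Finset (Equiv.Perm (Fin a))).filter
                (fun σ => ∀ i, (((eA (σ i) : Fin n), (eB i : Fin n)) ∈ G)),
                monomial (permMonomial σ) (1 : ℝ≥0)) * q) ≤
            complexity ((∑ σ ∈ (Finset.univ : Finset (Equiv.Perm (Fin n))).filter (fun σ => ∀ i, (σ i, i) ∈ G),
              monomial (permMonomial σ) (1 : ℝ≥0)) * h) + 1 := by
  intro n G h hh D _ A B a eA eB μ hex hle hG
  classical
  obtain ⟨m₀, hm₀, hm₀μ⟩ := hex
  obtain ⟨σ₀, hσ₀G, hσ₀⟩ := hG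
  set perG : MvPolynomial (Fin n × Fin n) ℝ≥0 :=
    ∑ σ ∈ (Finset.univ : Finset (Equiv.Perm (Fin n))).filter (fun σ => ∀ i, (σ i, i) ∈ G),
      monomial (permMonomial σ) (1 : ℝ≥0) with hperG
  set perG' : MvPolynomial (Fin a × Fin a) ℝ≥0 :=
    ∑ σ ∈ (Finset.univ : Finset (Equiv.Perm (Fin a))).filter
      (fun σ => ∀ i, (((eA (σ i) : Fin n), (eB i : Fin n)) ∈ G)),
      monomial (permMonomial σ) (1 : ℝ≥0) with hperG'
  -- the projection, by specification
  obtain ⟨prj, hpX, hp1, hpP⟩ : ∃ prj : Fin n × Fin n → MvPolynomial (Fin a × Fin a) ℝ≥0,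
      (∀ s t, prj ((eA s : Fin n), (eB t : Fin n)) = X (s, t)) ∧
      (∀ e : Fin n × Fin n, ¬ (e.1 ∈ A ∧ e.2 ∈ B) → prj e = 1) ∧
      ∀ e, (∃ v, prj e = X v) ∨ ∃ c, prj e = C c := by
    refine ⟨fun e => if hx : e.1 ∈ A ∧ e.2 ∈ B then
      X (eA.symm ⟨e.1, hx.1⟩, eB.symm ⟨e.2, hx.2⟩) else 1, fun s t => ?_, fun e he => dif_neg he,
      fun e => ?_⟩
    · dsimp only
      rw [dif_pos ⟨(eA s).2, (eB t).2⟩]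
      simp
    · dsimp only
      by_cases he : e.1 ∈ A ∧ e.2 ∈ B
      · exact Or.inl ⟨_, dif_pos he⟩
      · exact Or.inr ⟨1, by rw [dif_neg he, C_1]⟩
  -- (1) the weight: top forms (the `w`-weight is the block-diagonal mass)
  set w : Fin n × Fin n → ℕ := fun e => if (e.1 ∈ A ↔ e.2 ∈ B) then 1 else 0 with hw
  have hsuppT : ∀ d, d ∈ (topComponent w h).support ↔ d ∈ h.support ∧
      (d.filter (fun e : Fin n × Fin n => (e.1 ∈ A ↔ e.2 ∈ B))).degree = μ := fun d =>
    mem_support_topComponent_iff (fun e : Fin n × Fin n => (e.1 ∈ A ↔ e.2 ∈ B)) hm₀ hm₀μ hle d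
  have htopP : topComponent w perG = ∑ σ ∈ (Finset.univ : Finset (Equiv.Perm (Fin n))).filter
      (fun σ => (∀ i, (σ i, i) ∈ G) ∧ ∀ i, (σ i ∈ A ↔ i ∈ B)),
        monomial (permMonomial σ) (1 : ℝ≥0) :=
    topComponent_facePer_eq A B G hσ₀G hσ₀
  -- (2) the images under the projection
  obtain ⟨N, hN, hNeq⟩ := sum_aeval_prj_eq eA eB prj hpX hp1 G hσ₀G hσ₀
  have hS : aeval prj (topComponent w perG) = ((N : ℕ) : ℝ≥0) • perG' := by
    rw [htopP, map_sum]
    exact hNeq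
  obtain ⟨pb, hpb⟩ := exists_pb eA eB
  have hsupp : ∀ m' : (Fin a × Fin a) →₀ ℕ, m' ∈ (aeval prj (topComponent w h)).support ↔
      ∃ m ∈ h.support,
        (m.filter (fun e : Fin n × Fin n => (e.1 ∈ A ↔ e.2 ∈ B))).degree = μ ∧
        ∀ x y : Fin a, m' (x, y) = m ((eA x : Fin n), (eB y : Fin n)) := by
    intro m'
    rw [mem_support_aeval_prj_iff eA eB pb hpb prj hpX hp1]
    constructor
    · rintro ⟨d, hdT, hd⟩
      obtain ⟨hdh, hdμ⟩ := (hsuppT d).1 hdT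
      exact ⟨d, hdh, hdμ, (pb_eq_iff eA eB pb hpb d m').1 hd⟩
    · rintro ⟨m, hmh, hmμ, hm'⟩
      exact ⟨m, (hsuppT m).2 ⟨hmh, hmμ⟩, (pb_eq_iff eA eB pb hpb m m').2 hm'⟩
  -- (3) assemble
  refine ⟨aeval prj (topComponent w h), ?_, hsupp, ?_⟩
  · intro h0
    have hm := (hsupp (pb m₀)).2 ⟨m₀, hm₀, hm₀μ, fun x y => hpb m₀ x y⟩
    rw [h0, support_zero] at hm
    exact Finset.notMem_empty _ hm
  · exact complexity_mul_aeval_topComponent_le w prj hpP perG h perG'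
      (Nat.cast_ne_zero.2 hN) hS

end Summit.ValiantsHypothesis.ValiantsHypothesis.Theorems.DivisionGap.PerMultiplesHard.BlockSliceParts

end
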